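import Literature.Analysis.FunctionSpaces.WightmanGNS
import Mathlib.Analysis.InnerProductSpace.MeanErgodic
import Mathlib.Analysis.Asymptotics.SpecificAsymptotics
import HarnessLib

/-!
# Uniqueness of the vacuum in the GNS (Wightman reconstruction) Hilbert space

Streater–Wightman (1964), §3-4, proof of Thm. 3-7 (p. 119): the cluster decomposition
property (f) implies that the vacuum `Ω` is, up to scalars, the only translation-invariant
vector of the reconstructed theory. Here: for a spacelike `a` (which exists for `d ≥ 1`), the
von Neumann mean ergodic theorem (Mathlib, `tendsto_birkhoffAverage_orthogonalProjection`)
identifies the Cesàro limit of `U(na) x` with the projection `P x` onto the `U(a)`-fixed vectors,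
while (f) identifies the limit of `⟪y, U(ta) x⟫` with `⟪y, Ω⟫⟪Ω, x⟫` on the dense domain; hence
`P = |Ω⟩⟨Ω|` and every translation-invariant vector is a multiple of `Ω`.

## References
* R. F. Streater, A. S. Wightman, PCT, Spin and Statistics, and All That (1964), §3-4,
  Thm. 3-7.
-/

noncomputable section

open Filter Topology ComplexConjugate
open scoped InnerProductSpace SchwartzMap ComplexOrder

namespace Literature.Analysis.FunctionSpaces

namespace WightmanFamily

open Literature.MathematicalPhysics.QuantumLattice

namespace GNSSpace

variable {d : ℕ} {κ : Type*} {𝒲 : WightmanFamily d κ} {h𝒲 : IsWightmanFamily 𝒲}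

/-- The translation by `a` as an element of the Poincaré group. [folklore] -/
abbrev trans (a : SpaceTime d) : PoincareGroup d :=
  SemidirectProduct.inl (Multiplicative.ofAdd a)

/-- `trans` is additive. [folklore] -/
theorem trans_add (a b : SpaceTime d) : trans (d := d) (a + b) = trans a * trans b := by
  rw [trans, ofAdd_add, map_mul]

/-- Iterating `U(a)` gives `U(n a)`. [folklore] -/
theorem U_trans_iterate (a : SpaceTime d) (n : ℕ) (x : GNSHilbert 𝒲 h𝒲) :
    (fun y => U 𝒲 h𝒲 (trans a) y)^[n] x = U 𝒲 h𝒲 (trans ((n : ℝ) • a)) x := by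
  induction n with
  | zero =>
    simp only [Function.iterate_zero, id_eq, Nat.cast_zero, zero_smul]
    rw [trans, ofAdd_zero, map_one, U_one_apply]
  | succ n ih =>
    rw [Function.iterate_succ_apply', ih, ← U_mul_apply, ← trans_add]
    have h : a + (n : ℝ) • a = ((n + 1 : ℕ) : ℝ) • a := by
      push_cast
      module
    rw [h]

/-- **Cluster property for basis vectors**: `⟪[δ_l], U(t a) [δ_{l'}]⟫ → ⟪[δ_l], Ω⟫ ⟪Ω, [δ_{l'}]⟫`
as `t → ∞`, for spacelike `a` (from (f) on words and (c)). [folklore] -/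
theorem tendsto_inner_δ_U_δ (l l' : Word d κ) {a : SpaceTime d} (ha : IsSpacelike a) :
    Tendsto (fun t : ℝ => ⟪ι 𝒲 h𝒲 (δ 𝒲 h𝒲 l), U 𝒲 h𝒲 (trans (t • a)) (ι 𝒲 h𝒲 (δ 𝒲 h𝒲 l'))⟫_ℂ)
      atTop (𝓝 (⟪ι 𝒲 h𝒲 (δ 𝒲 h𝒲 l), vacuum 𝒲 h𝒲⟫_ℂ * ⟪vacuum 𝒲 h𝒲, ι 𝒲 h𝒲 (δ 𝒲 h𝒲 l')⟫_ℂ)) := by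
  have h := tendsto_eval_append_translate 𝒲 h𝒲.cluster (WightmanData.starList l) l' ha
  have h1 : ∀ t : ℝ, ⟪ι 𝒲 h𝒲 (δ 𝒲 h𝒲 l), U 𝒲 h𝒲 (trans (t • a)) (ι 𝒲 h𝒲 (δ 𝒲 h𝒲 l'))⟫_ℂ =
      eval 𝒲 (WightmanData.starList l ++ l'.map (actLetter (trans (t • a)))) := by
    intro t
    rw [U_ι, inner_ι_ι, act_δ, inner_δ_δ, pairing]
  have h2 : ⟪ι 𝒲 h𝒲 (δ 𝒲 h𝒲 l), vacuum 𝒲 h𝒲⟫_ℂ * ⟪vacuum 𝒲 h𝒲, ι 𝒲 h𝒲 (δ 𝒲 h𝒲 l')⟫_ℂ =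
      eval 𝒲 (WightmanData.starList l) * eval 𝒲 l' := by
    rw [vacuum, inner_ι_ι, inner_ι_ι, inner_δ_δ, inner_δ_δ, pairing, pairing, List.append_nil,
      WightmanData.starList_nil, List.nil_append]
  simp only [h1, h2]
  exact h

/-- Cluster property for vectors of the free space (sesquilinear extension). [folklore] -/
theorem tendsto_inner_U_ι (u v : GNSSpace 𝒲 h𝒲) {a : SpaceTime d} (ha : IsSpacelike a) :
    Tendsto (fun t : ℝ => ⟪ι 𝒲 h𝒲 u, U 𝒲 h𝒲 (trans (t • a)) (ι 𝒲 h𝒲 v)⟫_ℂ) atTop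
      (𝓝 (⟪ι 𝒲 h𝒲 u, vacuum 𝒲 h𝒲⟫_ℂ * ⟪vacuum 𝒲 h𝒲, ι 𝒲 h𝒲 v⟫_ℂ)) := by
  rw [← of_symm_eq u, ← of_symm_eq v]
  set u' := (of 𝒲 h𝒲).symm u
  set v' := (of 𝒲 h𝒲).symm v
  have hL : ∀ X : GNSHilbert 𝒲 h𝒲, ⟪ι 𝒲 h𝒲 (of 𝒲 h𝒲 u'), X⟫_ℂ =
      ∑ l ∈ u'.support, conj (u' l) * ⟪ι 𝒲 h𝒲 (δ 𝒲 h𝒲 l), X⟫_ℂ := by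
    intro X
    rw [of_eq_sum, map_sum, sum_inner]
    refine Finset.sum_congr rfl fun l _ => ?_
    rw [map_smul, inner_smul_left]
  have hR0 : ∀ Y : GNSHilbert 𝒲 h𝒲, ⟪Y, ι 𝒲 h𝒲 (of 𝒲 h𝒲 v')⟫_ℂ =
      ∑ l' ∈ v'.support, v' l' * ⟪Y, ι 𝒲 h𝒲 (δ 𝒲 h𝒲 l')⟫_ℂ := by
    intro Y
    rw [of_eq_sum, map_sum, inner_sum]
    refine Finset.sum_congr rfl fun l' _ => ?_
    rw [map_smul, inner_smul_right]
  have hRU : ∀ (t : ℝ) (Y : GNSHilbert 𝒲 h𝒲),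
      ⟪Y, U 𝒲 h𝒲 (trans (t • a)) (ι 𝒲 h𝒲 (of 𝒲 h𝒲 v'))⟫_ℂ =
        ∑ l' ∈ v'.support, v' l' * ⟪Y, U 𝒲 h𝒲 (trans (t • a)) (ι 𝒲 h𝒲 (δ 𝒲 h𝒲 l'))⟫_ℂ := by
    intro t Y
    rw [of_eq_sum, map_sum, map_sum, inner_sum]
    refine Finset.sum_congr rfl fun l' _ => ?_
    rw [map_smul, map_smul, inner_smul_right]
  have hlim : ⟪ι 𝒲 h𝒲 (of 𝒲 h𝒲 u'), vacuum 𝒲 h𝒲⟫_ℂ * ⟪vacuum 𝒲 h𝒲, ι 𝒲 h𝒲 (of 𝒲 h𝒲 v')⟫_ℂ =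
      ∑ l ∈ u'.support, ∑ l' ∈ v'.support, conj (u' l) * (v' l' *
        (⟪ι 𝒲 h𝒲 (δ 𝒲 h𝒲 l), vacuum 𝒲 h𝒲⟫_ℂ * ⟪vacuum 𝒲 h𝒲, ι 𝒲 h𝒲 (δ 𝒲 h𝒲 l')⟫_ℂ)) := by
    rw [hL, hR0, Finset.sum_mul_sum]
    refine Finset.sum_congr rfl fun l _ => Finset.sum_congr rfl fun l' _ => ?_
    ring
  have hfun : ∀ t : ℝ, ⟪ι 𝒲 h𝒲 (of 𝒲 h𝒲 u'), U 𝒲 h𝒲 (trans (t • a)) (ι 𝒲 h𝒲 (of 𝒲 h𝒲 v'))⟫_ℂ =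
      ∑ l ∈ u'.support, ∑ l' ∈ v'.support, conj (u' l) * (v' l' *
        ⟪ι 𝒲 h𝒲 (δ 𝒲 h𝒲 l), U 𝒲 h𝒲 (trans (t • a)) (ι 𝒲 h𝒲 (δ 𝒲 h𝒲 l'))⟫_ℂ) := by
    intro t
    rw [hL]
    refine Finset.sum_congr rfl fun l _ => ?_
    rw [hRU, Finset.mul_sum]
  rw [hlim]
  simp only [hfun]
  refine tendsto_finsetSum _ fun l _ => tendsto_finsetSum _ fun l' _ => ?_
  exact ((tendsto_inner_δ_U_δ (h𝒲 := h𝒲) l l' ha).const_mul (v' l')).const_mul (conj (u' l))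

/-- A spacelike vector exists in `1 + d` dimensions for `d ≥ 1`: the first spatial unit vector. [folklore] -/
theorem isSpacelike_single_one [NeZero d] :
    IsSpacelike (EuclideanSpace.single (Fin.succ (0 : Fin d)) (1 : ℝ) : SpaceTime d) := by
  set v : SpaceTime d := EuclideanSpace.single (Fin.succ (0 : Fin d)) (1 : ℝ)
  rw [IsSpacelike, minkowskiForm_self]
  have h0 : v 0 = 0 := by simp [v]
  have hne : spaceC d v ≠ 0 := fun h => by
    have h1 : spaceC d v 0 = 0 := by rw [h]; rfl
    rw [spaceC_apply] at h1
    simp [v] at h1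
  have hpos := norm_pos_iff.2 hne
  rw [h0]
  nlinarith [hpos]

/-- **The projection onto the `U(a)`-fixed vectors is `|Ω⟩⟨Ω|`** for spacelike `a`: the mean
ergodic limit of `U(n a) x` is `⟪Ω, x⟫ Ω` (Streater–Wightman (1964), §3-4, p. 119). [cite: StreaterWightman1964, §3-4] -/
theorem orthogonalProjectionOnto_fixed_eq {a : SpaceTime d} (ha : IsSpacelike a) (x : GNSHilbert 𝒲 h𝒲) :
    (((U 𝒲 h𝒲 (trans a) : GNSHilbert 𝒲 h𝒲 →L[ℂ] GNSHilbert 𝒲 h𝒲).eqLocus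
        (1 : GNSHilbert 𝒲 h𝒲 →L[ℂ] GNSHilbert 𝒲 h𝒲)).orthogonalProjectionOnto x : GNSHilbert 𝒲 h𝒲) =
      ⟪vacuum 𝒲 h𝒲, x⟫_ℂ • vacuum 𝒲 h𝒲 := by
  set T : GNSHilbert 𝒲 h𝒲 →L[ℂ] GNSHilbert 𝒲 h𝒲 :=
    ((U 𝒲 h𝒲 (trans a)).toContinuousLinearEquiv : GNSHilbert 𝒲 h𝒲 →L[ℂ] GNSHilbert 𝒲 h𝒲)
  set K := T.eqLocus (1 : GNSHilbert 𝒲 h𝒲 →L[ℂ] GNSHilbert 𝒲 h𝒲)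
  have hT : ‖T‖ ≤ 1 := (U 𝒲 h𝒲 (trans a)).toLinearIsometry.norm_toContinuousLinearMap_le
  have hiter : ∀ (n : ℕ) (y : GNSHilbert 𝒲 h𝒲), (⇑T)^[n] y = U 𝒲 h𝒲 (trans ((n : ℝ) • a)) y :=
    fun n y => U_trans_iterate a n y
  -- Step 1: on the dense domain, `⟪y, P x⟫ = ⟪y, Ω⟫ ⟪Ω, x⟫`
  have step1 : ∀ u v : GNSSpace 𝒲 h𝒲,
      ⟪ι 𝒲 h𝒲 u, (K.orthogonalProjectionOnto (ι 𝒲 h𝒲 v) : GNSHilbert 𝒲 h𝒲)⟫_ℂ =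
        ⟪ι 𝒲 h𝒲 u, vacuum 𝒲 h𝒲⟫_ℂ * ⟪vacuum 𝒲 h𝒲, ι 𝒲 h𝒲 v⟫_ℂ := by
    intro u v
    have hmean := T.tendsto_birkhoffAverage_orthogonalProjection hT (ι 𝒲 h𝒲 v)
    have hlim1 : Tendsto (fun N : ℕ => ⟪ι 𝒲 h𝒲 u, birkhoffAverage ℂ T _root_.id N (ι 𝒲 h𝒲 v)⟫_ℂ)
        atTop (𝓝 ⟪ι 𝒲 h𝒲 u, (K.orthogonalProjectionOnto (ι 𝒲 h𝒲 v) : GNSHilbert 𝒲 h𝒲)⟫_ℂ) :=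
      (continuous_inner.comp (continuous_const.prodMk continuous_id)).continuousAt.tendsto.comp
        hmean
    -- the sequence `⟪y, Tⁿ x⟫` converges by the cluster property, hence so do its Cesàro means
    have hseq : Tendsto (fun n : ℕ => ⟪ι 𝒲 h𝒲 u, (⇑T)^[n] (ι 𝒲 h𝒲 v)⟫_ℂ) atTop
        (𝓝 (⟪ι 𝒲 h𝒲 u, vacuum 𝒲 h𝒲⟫_ℂ * ⟪vacuum 𝒲 h𝒲, ι 𝒲 h𝒲 v⟫_ℂ)) := by
      simp only [hiter]
      exact (tendsto_inner_U_ι u v ha).comp tendsto_natCast_atTop_atTop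
    have hces := hseq.cesaro_smul
    have hlim2 : Tendsto (fun N : ℕ => ⟪ι 𝒲 h𝒲 u, birkhoffAverage ℂ T _root_.id N (ι 𝒲 h𝒲 v)⟫_ℂ)
        atTop (𝓝 (⟪ι 𝒲 h𝒲 u, vacuum 𝒲 h𝒲⟫_ℂ * ⟪vacuum 𝒲 h𝒲, ι 𝒲 h𝒲 v⟫_ℂ)) := by
      refine hces.congr fun N => ?_
      rw [birkhoffAverage, birkhoffSum, inner_smul_right, inner_sum]
      simp only [_root_.id]
      rw [Complex.real_smul]
      congr 1
      simp
    exact tendsto_nhds_unique hlim1 hlim2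
  -- Step 2: `P x = ⟪Ω, x⟫ Ω` on the dense domain
  have step2 : ∀ v : GNSSpace 𝒲 h𝒲,
      (K.orthogonalProjectionOnto (ι 𝒲 h𝒲 v) : GNSHilbert 𝒲 h𝒲) =
        ⟪vacuum 𝒲 h𝒲, ι 𝒲 h𝒲 v⟫_ℂ • vacuum 𝒲 h𝒲 := by
    intro v
    refine DenseRange.eq_of_inner_right (𝕜 := ℂ) denseRange_ι fun u => ?_
    rw [step1, inner_smul_right, mul_comm]
  -- Step 3: extend by continuity
  refine denseRange_ι.induction_on x ?_ step2
  exact isClosed_eq (continuous_subtype_val.comp K.orthogonalProjectionOnto.continuous)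
    (by fun_prop : Continuous fun b : GNSHilbert 𝒲 h𝒲 => ⟪vacuum 𝒲 h𝒲, b⟫_ℂ • vacuum 𝒲 h𝒲)

/-- **Uniqueness of the vacuum**: a vector invariant under all translations is a multiple of
`Ω` (Streater–Wightman (1964), §3-4, Thm. 3-7, from the cluster property (f)); `d ≥ 1` is
needed for a spacelike direction to exist. [cite: StreaterWightman1964, §3-4 Thm. 3-7] -/
theorem mem_span_vacuum_of_invariant [NeZero d] {ψ : GNSHilbert 𝒲 h𝒲}
    (hψ : ∀ a : SpaceTime d, U 𝒲 h𝒲 (trans a) ψ = ψ) : ψ ∈ ℂ ∙ vacuum 𝒲 h𝒲 := by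
  set a : SpaceTime d := EuclideanSpace.single (Fin.succ (0 : Fin d)) (1 : ℝ)
  have ha : IsSpacelike a := isSpacelike_single_one
  set T : GNSHilbert 𝒲 h𝒲 →L[ℂ] GNSHilbert 𝒲 h𝒲 :=
    ((U 𝒲 h𝒲 (trans a)).toContinuousLinearEquiv : GNSHilbert 𝒲 h𝒲 →L[ℂ] GNSHilbert 𝒲 h𝒲)
  set K := T.eqLocus (1 : GNSHilbert 𝒲 h𝒲 →L[ℂ] GNSHilbert 𝒲 h𝒲)
  have hK : ψ ∈ K := by
    change T ψ = (1 : GNSHilbert 𝒲 h𝒲 →L[ℂ] GNSHilbert 𝒲 h𝒲) ψ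
    exact hψ a
  have hP : (K.orthogonalProjectionOnto ψ : GNSHilbert 𝒲 h𝒲) = ψ := by
    have := K.orthogonalProjectionOnto_mem_subspace_eq_self ⟨ψ, hK⟩
    rw [this]
  rw [Submodule.mem_span_singleton]
  exact ⟨⟪vacuum 𝒲 h𝒲, ψ⟫_ℂ, by rw [← orthogonalProjectionOnto_fixed_eq ha ψ, hP]⟩

/-- The translation-invariant vectors are exactly the multiples of the vacuum (`d ≥ 1`). [folklore] -/
theorem invariant_iff_mem_span_vacuum [NeZero d] (ψ : GNSHilbert 𝒲 h𝒲) :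
    (∀ a : Multiplicative (SpaceTime d), translHom 𝒲 h𝒲 a ψ = ψ) ↔ ψ ∈ ℂ ∙ vacuum 𝒲 h𝒲 := by
  constructor
  · intro h
    exact mem_span_vacuum_of_invariant fun a => h (Multiplicative.ofAdd a)
  · intro h a
    obtain ⟨c, rfl⟩ := Submodule.mem_span_singleton.1 h
    rw [map_smul, translHom_apply, U_vacuum]

end GNSSpace

end WightmanFamily

end Literature.Analysis.FunctionSpaces
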